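import Summits.QuantumAdvantage.QuantumAdvantage.Theorems.SymplecticPurityGraphStateSpectrum
import Summits.QuantumAdvantage.QuantumAdvantage.Theorems.SymplecticPurityDlogGraphFlatOrbitFibre
import Summits.QuantumAdvantage.QuantumAdvantage.Theorems.SymplecticPurityDlogGraphFlatCongCount
import Literature.Computability.AlgebraicComplexity.BooleanGadgets

/-!
# Crux `DlogGraphFlat` (stmt-QuantumAdvantage-10732), line `Sketch` — sector A flank, part A

XOR-differential counts of the DLOG S-box `f x = bits (g^{ofBits x} mod p)` on `n`-bit registers:
`D(a,a') = #{x : f (x ⊕ a) = f x ⊕ a'}`. Splitting `x` into its bits on the support of the mask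
`a` (value `W = ofBits (x ∧ a)`) and off it (value `V`) gives, modulo `p`, the ratio form
`f(x⊕a) · g^{2W} ≡ g^A · f(x)` and the product form `f(x⊕a) · f(x) ≡ g^{A+2V}` (`A = ofBits a`).
With the congruence counts `stub_dlogCongCount` (linear on the generic multiplier classes,
quadratic on everything) and the fibre bound `stub_dlogOrbitFibre` this yields the registered stub
`stub_dlogDiffFlankA`:
`D(a,a') ≤ 2^{m(a)+m(a')+3} + #{x : g^A = (g^W)² ∨ g^A = −(g^W)²}`, `m(·) = min(|·|, n − |·|)`.
The exceptional classes `g^A = ±(g^W)²` are priced by the NAF guard in part B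
(`stub_dlogDiffFlank`). No new definitions: masks are written as the lambdas
`fun j => x j && a j` (bits on `a`), `fun j => x j && !a j` (bits off `a`),
`fun j => Bool.xor (x j) (a j)` (flip on `a`).
-/

set_option linter.dupNamespace false -- D-0017: single-problem summit ⇒ `QuantumAdvantage.QuantumAdvantage` by design

namespace Summit.QuantumAdvantage.QuantumAdvantage.Theorems.SymplecticPurity

open Finset Literature.Computability.QuantumComplexity Literature.Computability.Cryptography
open Literature.Computability.AlgebraicComplexity.BoolGadgets (ofBits_eq_sum ofBits_injective)

variable {n : ℕ}

/-! ### Bit algebra of a mask split -/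

/-- The number of `false` coordinates of a mask is `n − |a|`. -/
theorem card_filter_false_eq (a : QReg n) :
    (Finset.univ.filter fun j => a j = false).card =
      n - (Finset.univ.filter fun j => a j = true).card := by
  have h := Finset.card_filter_add_card_filter_not (s := (Finset.univ : Finset (Fin n)))
    (fun j => a j = true)
  simp only [Finset.card_univ, Fintype.card_fin] at h
  have h' : (Finset.univ.filter fun j => ¬ a j = true) = Finset.univ.filter fun j => a j = false := by
    ext j; simp
  rw [h'] at h
  omega

/-- `ofBits x = W + V`: the value of `x` splits over the two halves of the mask. -/
theorem ofBits_split (x a : QReg n) :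
    Nat.ofBits x = Nat.ofBits (fun j => x j && a j) + Nat.ofBits (fun j => x j && !a j) := by
  rw [ofBits_eq_sum, ofBits_eq_sum, ofBits_eq_sum, ← Finset.sum_add_distrib]
  refine Finset.sum_congr rfl fun t _ => ?_
  cases x t <;> cases a t <;> simp

/-- `ofBits (x ⊕ a) + W = A + V`: flipping the bits on the mask complements `W` inside `A`. -/
theorem ofBits_flip_add (x a : QReg n) :
    Nat.ofBits (fun j => Bool.xor (x j) (a j)) + Nat.ofBits (fun j => x j && a j) =
      Nat.ofBits a + Nat.ofBits (fun j => x j && !a j) := by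
  rw [ofBits_eq_sum, ofBits_eq_sum, ofBits_eq_sum, ofBits_eq_sum, ← Finset.sum_add_distrib,
    ← Finset.sum_add_distrib]
  refine Finset.sum_congr rfl fun t _ => ?_
  cases x t <;> cases a t <;> simp

/-- A label is determined by its two halves. -/
theorem eq_of_bits_in_out {x x' a : QReg n} (h₁ : (fun j => x j && a j) = fun j => x' j && a j)
    (h₂ : (fun j => x j && !a j) = fun j => x' j && !a j) : x = x' := by
  funext j
  have e₁ := congrFun h₁ j
  have e₂ := congrFun h₂ j
  revert e₁ e₂
  cases x j <;> cases x' j <;> cases a j <;> simp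

/-- There are at most `2^{|a|}` patterns `x ∧ a`. -/
theorem card_image_bits_in_le (a : QReg n) :
    (Finset.univ.image fun x : QReg n => fun j => x j && a j).card ≤
      2 ^ (Finset.univ.filter fun j => a j = true).card := by
  classical
  set T := (Finset.univ.filter fun j => a j = true) with hT
  have hcard : (Finset.univ : Finset (T → Bool)).card = 2 ^ T.card := by
    rw [Finset.card_univ, Fintype.card_fun, Fintype.card_bool, Fintype.card_coe]
  rw [← hcard]
  refine Finset.card_le_card_of_injOn (fun w (j : T) => w j)
    (fun _ _ => Finset.mem_coe.2 (Finset.mem_univ _)) ?_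
  intro w hw w' hw' hww
  simp only [Finset.coe_image, Finset.coe_univ, Set.image_univ, Set.mem_range] at hw hw'
  obtain ⟨x, rfl⟩ := hw
  obtain ⟨x', rfl⟩ := hw'
  funext j
  by_cases hj : a j = true
  · have := congrFun hww ⟨j, by rw [hT]; simpa using hj⟩
    simpa using this
  · simp [Bool.eq_false_iff.mpr hj]

/-- There are at most `2^{n−|a|}` patterns `x ∧ ā`. -/
theorem card_image_bits_out_le (a : QReg n) :
    (Finset.univ.image fun x : QReg n => fun j => x j && !a j).card ≤
      2 ^ (n - (Finset.univ.filter fun j => a j = true).card) := by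
  classical
  set T := (Finset.univ.filter fun j => a j = false) with hT
  have hcard : (Finset.univ : Finset (T → Bool)).card =
      2 ^ (n - (Finset.univ.filter fun j => a j = true).card) := by
    rw [Finset.card_univ, Fintype.card_fun, Fintype.card_bool, Fintype.card_coe, card_filter_false_eq]
  rw [← hcard]
  refine Finset.card_le_card_of_injOn (fun w (j : T) => w j)
    (fun _ _ => Finset.mem_coe.2 (Finset.mem_univ _)) ?_
  intro w hw w' hw' hww
  simp only [Finset.coe_image, Finset.coe_univ, Set.image_univ, Set.mem_range] at hw hw'
  obtain ⟨x, rfl⟩ := hw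
  obtain ⟨x', rfl⟩ := hw'
  funext j
  by_cases hj : a j = false
  · have := congrFun hww ⟨j, by rw [hT]; simpa using hj⟩
    simpa using this
  · have hj' : a j = true := by
      cases h : a j
      · exact absurd h hj
      · rfl
    simp [hj']

/-- A class `{x : ofBits (x ∧ a) = c}` has at most `2^{n−|a|}` elements. -/
theorem card_filter_bits_in_val_le (a : QReg n) (c : ℕ) :
    (Finset.univ.filter fun x : QReg n => Nat.ofBits (fun j => x j && a j) = c).card ≤
      2 ^ (n - (Finset.univ.filter fun j => a j = true).card) := by
  classical
  refine le_trans ?_ (card_image_bits_out_le a)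
  refine Finset.card_le_card_of_injOn (fun x => fun j => x j && !a j) (fun x _ => ?_) ?_
  · exact Finset.mem_coe.2 (Finset.mem_image_of_mem _ (Finset.mem_univ _))
  · intro x hx x' hx' h
    rw [Finset.mem_coe, Finset.mem_filter] at hx hx'
    exact eq_of_bits_in_out (ofBits_injective (hx.2.trans hx'.2.symm)) h

/-! ### The S-box `x ↦ bits (gˣ mod p)` and its fibres -/

section SBox

variable {p g : ℕ} {f : QReg n → QReg n}

/-- Casting `gᵐ mod p` into `ZMod p` gives `gᵐ`. -/
theorem cast_pow_mod (hp : p.Prime) (m : ℕ) : ((g ^ m % p : ℕ) : ZMod p) = (g : ZMod p) ^ m := by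
  haveI := Fact.mk hp
  rw [ZMod.natCast_mod, Nat.cast_pow]

/-- The S-box value read back as a number is `gˣ mod p` (because `p < 2ⁿ`). -/
theorem ofBits_sbox (hf : ∀ x j, f x j = (g ^ Nat.ofBits x % p).testBit (j : ℕ))
    (hp : p.Prime) (hpn : p < 2 ^ n) (x : QReg n) :
    Nat.ofBits (f x) = g ^ Nat.ofBits x % p := by
  rw [show f x = fun j : Fin n => (g ^ Nat.ofBits x % p).testBit (j : ℕ) from funext (hf x),
    Nat.ofBits_testBit, Nat.mod_eq_of_lt ((Nat.mod_lt _ hp.pos).trans hpn)]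

/-- The S-box value in `ZMod p` is the power `g^{ofBits x}`. -/
theorem cast_ofBits_sbox (hf : ∀ x j, f x j = (g ^ Nat.ofBits x % p).testBit (j : ℕ))
    (hp : p.Prime) (hpn : p < 2 ^ n) (x : QReg n) :
    ((Nat.ofBits (f x) : ℕ) : ZMod p) = (g : ZMod p) ^ Nat.ofBits x := by
  rw [ofBits_sbox hf hp hpn, cast_pow_mod hp]

/-- Preimages of a bit vector under the S-box: at most two (`stub_dlogOrbitFibre`). -/
theorem card_filter_sbox_eq_le (hf : ∀ x j, f x j = (g ^ Nat.ofBits x % p).testBit (j : ℕ))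
    (hp : p.Prime) (hpn : p < 2 ^ n) (hg : orderOf (g : ZMod p) = p - 1)
    (h2 : 2 ^ n ≤ 2 * (p - 1)) (yv : QReg n) :
    (Finset.univ.filter fun x : QReg n => f x = yv).card ≤ 2 := by
  classical
  refine le_trans (Finset.card_le_card ?_)
    (stub_dlogOrbitFibre n p g hp hg h2 (Nat.ofBits yv : ZMod p))
  intro x hx
  rw [Finset.mem_filter] at hx ⊢
  refine ⟨hx.1, ?_⟩
  rw [← cast_ofBits_sbox hf hp hpn x, hx.2]

/-- Points whose S-box value lies in a set `L`: at most `2 |L|`. -/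
theorem card_filter_sbox_mem_le (hf : ∀ x j, f x j = (g ^ Nat.ofBits x % p).testBit (j : ℕ))
    (hp : p.Prime) (hpn : p < 2 ^ n) (hg : orderOf (g : ZMod p) = p - 1)
    (h2 : 2 ^ n ≤ 2 * (p - 1)) (L : Finset (QReg n)) :
    (Finset.univ.filter fun x : QReg n => f x ∈ L).card ≤ 2 * L.card := by
  classical
  refine Finset.card_le_mul_card_image_of_maps_to (f := f) (t := L)
    (fun x hx => (Finset.mem_filter.1 hx).2) 2 fun yv _ => ?_
  rw [Finset.filter_filter]
  refine le_trans (Finset.card_le_card ?_) (card_filter_sbox_eq_le hf hp hpn hg h2 yv)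
  intro x hx
  simp only [Finset.mem_filter, Finset.mem_univ, true_and] at hx ⊢
  exact hx.2

end SBox

/-! ### The multiplier classes -/

/-- **Stub `stub_dlogDiffFlankA` (sector A flank, part A).** Under the crux's window and
primitivity hypotheses and `4 ≤ n`, the XOR-differential count satisfies
`D(a,a') ≤ 2^{m(a)+m(a')+3} + #{x : g^A = (g^{W x})² ∨ g^A = −(g^{W x})²}`
(`W x = ofBits (x ∧ a)`, `A = ofBits a`, `m(·) = min(|·|, n − |·|)`): classes of `x` by `x ∧ a`
have multiplier `h = g^A/(g^W)²` with `f(x⊕a) ≡ h·f(x)`; for `h ∉ {±1}` the ratio form and the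
linear congruence count give `2^{|a|+m(a')+2}` (only used when `|a| ≤ n/2`), the product form
`f(x⊕a)·f(x) ≡ g^{A+2V}` with the quadratic count gives `2^{n−|a|+m(a')+3}` for everything. -/
theorem stub_dlogDiffFlankA : ∀ (n p g : ℕ), p.Prime → p < 2 ^ n → 2 ^ n ≤ p + 2 ^ (53 * n / 100) →
    orderOf (g : ZMod p) = p - 1 → 4 ≤ n → ∀ a a' : QReg n,
    (Finset.univ.filter fun x : QReg n =>
        (fun i : Fin n => Bool.xor ((g ^ Nat.ofBits (fun j => Bool.xor (x j) (a j)) % p).testBit (i : ℕ))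
          ((g ^ Nat.ofBits x % p).testBit (i : ℕ))) = a').card
      ≤ 2 ^ (min (Finset.univ.filter fun i => a i = true).card
              (n - (Finset.univ.filter fun i => a i = true).card) +
            min (Finset.univ.filter fun j => a' j = true).card
              (n - (Finset.univ.filter fun j => a' j = true).card) + 3) +
        (Finset.univ.filter fun x : QReg n =>
          (g : ZMod p) ^ Nat.ofBits a = ((g : ZMod p) ^ Nat.ofBits (fun j => x j && a j)) ^ 2 ∨
          (g : ZMod p) ^ Nat.ofBits a = -((g : ZMod p) ^ Nat.ofBits (fun j => x j && a j)) ^ 2).card := by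
  intro n p g hp hpn hwin hg hn a a'
  classical
  haveI := Fact.mk hp
  -- numerics of the window
  have h53 : 53 * n / 100 ≤ n - 2 := by omega
  have hq : 2 ^ (53 * n / 100) ≤ 2 ^ (n - 2) := Nat.pow_le_pow_right (by norm_num) h53
  have h2n : 2 ^ n = 4 * 2 ^ (n - 2) := by
    conv_lhs => rw [show n = (n - 2) + 2 from by omega, Nat.pow_add]
    ring
  have hq4 : 4 ≤ 2 ^ (n - 2) := by
    calc 4 = 2 ^ 2 := by norm_num
      _ ≤ 2 ^ (n - 2) := Nat.pow_le_pow_right (by norm_num) (by omega)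
  have hp3 : 3 * 2 ^ (n - 2) ≤ p := by omega
  have h2p : 2 ^ n ≤ 2 * p := by omega
  have h2p1 : 2 ^ n ≤ 2 * (p - 1) := by omega
  -- notation
  set wa : ℕ := (Finset.univ.filter fun i => a i = true).card with hwa
  set wa' : ℕ := (Finset.univ.filter fun j => a' j = true).card with hwa'
  set G : ZMod p := (g : ZMod p) with hG
  set A : ℕ := Nat.ofBits a with hA
  set f : QReg n → QReg n := fun x j => (g ^ Nat.ofBits x % p).testBit (j : ℕ) with hf
  have hf' : ∀ x j, f x j = (g ^ Nat.ofBits x % p).testBit (j : ℕ) := fun x j => rfl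
  have hG0 : G ≠ 0 := by
    intro h0
    rw [h0, orderOf_eq_zero_iff'.mpr] at hg
    · have := hp.two_le; omega
    · intro m hm h1
      rw [zero_pow (Nat.pos_iff_ne_zero.mp hm)] at h1
      exact zero_ne_one h1
  -- the exceptional predicate
  set P : QReg n → Prop := fun x =>
      G ^ A = (G ^ Nat.ofBits (fun j => x j && a j)) ^ 2 ∨
        G ^ A = -(G ^ Nat.ofBits (fun j => x j && a j)) ^ 2 with hP
  -- the differential set; membership rewritten through `f`
  set S := (Finset.univ.filter fun x : QReg n =>
        (fun i : Fin n => Bool.xor ((g ^ Nat.ofBits (fun j => Bool.xor (x j) (a j)) % p).testBit (i : ℕ))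
          ((g ^ Nat.ofBits x % p).testBit (i : ℕ))) = a') with hS
  have hSmem : ∀ x ∈ S,
      f (fun j => Bool.xor (x j) (a j)) = fun j => Bool.xor (f x j) (a' j) := by
    intro x hx
    rw [hS, Finset.mem_filter] at hx
    funext i
    have := congrFun hx.2 i
    simp only [hf']
    rw [← this]
    cases (g ^ Nat.ofBits (fun j => (x j).xor (a j)) % p).testBit i <;>
      cases (g ^ Nat.ofBits x % p).testBit i <;> rfl
  -- the two algebraic forms, valid on `S`
  have hratio : ∀ x ∈ S,
      (Nat.ofBits (fun j => Bool.xor (f x j) (a' j)) : ZMod p) *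
          (G ^ Nat.ofBits (fun j => x j && a j)) ^ 2 = G ^ A * (Nat.ofBits (f x) : ZMod p) := by
    intro x hx
    rw [← hSmem x hx, cast_ofBits_sbox hf' hp hpn, cast_ofBits_sbox hf' hp hpn, ← hG, ← pow_mul,
      ← pow_add, ← pow_add]
    congr 1
    have e1 := ofBits_flip_add x a
    have e2 := ofBits_split x a
    rw [← hA] at e1
    omega
  have hprod : ∀ x ∈ S,
      (Nat.ofBits (f x) : ZMod p) * (Nat.ofBits (fun j => Bool.xor (f x j) (a' j)) : ZMod p) =
        G ^ (A + 2 * Nat.ofBits (fun j => x j && !a j)) := by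
    intro x hx
    rw [← hSmem x hx, cast_ofBits_sbox hf' hp hpn, cast_ofBits_sbox hf' hp hpn, ← hG, ← pow_add]
    congr 1
    have e1 := ofBits_flip_add x a
    have e2 := ofBits_split x a
    rw [← hA] at e1
    omega
  -- generic / exceptional split
  have hsplit : S.card ≤ (S.filter fun x => ¬ P x).card + (Finset.univ.filter fun x => P x).card := by
    have h1 := Finset.card_filter_add_card_filter_not (s := S) P
    have hle : (S.filter P).card ≤ (Finset.univ.filter fun x => P x).card :=
      Finset.card_le_card (Finset.filter_subset_filter _ (Finset.subset_univ _))
    omega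
  -- congruence counts for `a'`
  obtain ⟨hlin, hquad⟩ := stub_dlogCongCount n p hp h2p a'
  -- (R) ratio form on the generic classes
  have hR : (S.filter fun x => ¬ P x).card ≤ 2 ^ (min wa' (n - wa') + 2) * 2 ^ wa := by
    refine le_trans (Finset.card_le_mul_card_image_of_maps_to (f := fun x => fun j => x j && a j)
      (t := Finset.univ.image fun x : QReg n => fun j => x j && a j)
      (fun x _ => Finset.mem_image.mpr ⟨x, Finset.mem_univ _, rfl⟩) _ ?_)
      (Nat.mul_le_mul_left _ (card_image_bits_in_le a))
    intro w _
    set u : ZMod p := (G ^ Nat.ofBits w) ^ 2 with hu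
    have hu0 : u ≠ 0 := pow_ne_zero _ (pow_ne_zero _ hG0)
    set h : ZMod p := G ^ A / u with hh
    set L := (Finset.univ.filter fun y : QReg n =>
        h * (Nat.ofBits y : ZMod p) = (Nat.ofBits (fun j => Bool.xor (y j) (a' j)) : ZMod p)) with hL
    by_cases hgen : (G ^ A = u ∨ G ^ A = -u)
    · -- the class of `w` is exceptional: the generic fibre over `w` is empty
      have : ((S.filter fun x => ¬ P x).filter fun x => (fun j => x j && a j) = w) = ∅ := by
        refine Finset.filter_eq_empty_iff.mpr fun x hx hxw => ?_
        rw [Finset.mem_filter] at hx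
        apply hx.2
        show G ^ A = (G ^ Nat.ofBits (fun j => x j && a j)) ^ 2 ∨
          G ^ A = -(G ^ Nat.ofBits (fun j => x j && a j)) ^ 2
        rw [hxw]
        exact hgen
      rw [this, Finset.card_empty]
      exact Nat.zero_le _
    · push Not at hgen
      have hh1 : h ≠ 1 := fun h1 => hgen.1 ((div_eq_one_iff_eq hu0).mp h1)
      have hh2 : h ≠ -1 := fun h1 => hgen.2 (by rw [(div_eq_iff hu0).mp h1]; ring)
      have hLcard := hlin h hh1 hh2
      calc ((S.filter fun x => ¬ P x).filter fun x => (fun j => x j && a j) = w).card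
          ≤ (Finset.univ.filter fun x : QReg n => f x ∈ L).card := by
            refine Finset.card_le_card fun x hx => ?_
            rw [Finset.mem_filter] at hx
            obtain ⟨hx, hxw⟩ := hx
            rw [Finset.mem_filter] at hx
            rw [Finset.mem_filter, hL, Finset.mem_filter]
            refine ⟨Finset.mem_univ _, Finset.mem_univ _, ?_⟩
            have e := hratio x hx.1
            rw [hxw] at e
            rw [hh, div_mul_eq_mul_div, div_eq_iff hu0, hu]
            exact e.symm
        _ ≤ 2 * L.card := card_filter_sbox_mem_le hf' hp hpn hg h2p1 L
        _ ≤ 2 * 2 ^ (min wa' (n - wa') + 1) := Nat.mul_le_mul_left 2 hLcard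
        _ = 2 ^ (min wa' (n - wa') + 2) := by ring
  -- (P) product form on everything
  have hPr : S.card ≤ 2 ^ (min wa' (n - wa') + 3) * 2 ^ (n - wa) := by
    refine le_trans (Finset.card_le_mul_card_image_of_maps_to (f := fun x => fun j => x j && !a j)
      (t := Finset.univ.image fun x : QReg n => fun j => x j && !a j)
      (fun x _ => Finset.mem_image.mpr ⟨x, Finset.mem_univ _, rfl⟩) _ ?_)
      (Nat.mul_le_mul_left _ (card_image_bits_out_le a))
    intro v _
    set K : ZMod p := G ^ (A + 2 * Nat.ofBits v) with hK
    set Q := (Finset.univ.filter fun y : QReg n =>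
        (Nat.ofBits y : ZMod p) * (Nat.ofBits (fun j => Bool.xor (y j) (a' j)) : ZMod p) = K) with hQ
    have hQcard := hquad K
    calc (S.filter fun x => (fun j => x j && !a j) = v).card
        ≤ (Finset.univ.filter fun x : QReg n => f x ∈ Q).card := by
          refine Finset.card_le_card fun x hx => ?_
          rw [Finset.mem_filter] at hx
          obtain ⟨hx, hxv⟩ := hx
          rw [Finset.mem_filter, hQ, Finset.mem_filter]
          refine ⟨Finset.mem_univ _, Finset.mem_univ _, ?_⟩
          have e := hprod x hx
          rw [hxv] at e
          rw [e]
      _ ≤ 2 * Q.card := card_filter_sbox_mem_le hf' hp hpn hg h2p1 Q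
      _ ≤ 2 * 2 ^ (min wa' (n - wa') + 2) := Nat.mul_le_mul_left 2 hQcard
      _ = 2 ^ (min wa' (n - wa') + 3) := by ring
  -- assemble
  by_cases hT : wa ≤ n - wa
  · rw [min_eq_left hT]
    calc S.card ≤ (S.filter fun x => ¬ P x).card + (Finset.univ.filter fun x => P x).card := hsplit
      _ ≤ 2 ^ (min wa' (n - wa') + 2) * 2 ^ wa + (Finset.univ.filter fun x => P x).card :=
          Nat.add_le_add_right hR _
      _ ≤ 2 ^ (wa + min wa' (n - wa') + 3) + (Finset.univ.filter fun x => P x).card := by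
          refine Nat.add_le_add_right ?_ _
          rw [← Nat.pow_add]
          exact Nat.pow_le_pow_right (by norm_num) (by omega)
  · push Not at hT
    rw [min_eq_right hT.le]
    calc S.card ≤ 2 ^ (min wa' (n - wa') + 3) * 2 ^ (n - wa) := hPr
      _ = 2 ^ (n - wa + min wa' (n - wa') + 3) := by rw [← Nat.pow_add]; ring_nf
      _ ≤ _ := Nat.le_add_right _ _

end Summit.QuantumAdvantage.QuantumAdvantage.Theorems.SymplecticPurity
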